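import Summits.NavierStokesRegularity.NavierStokesRegularity.Theses.RellichScar
import Summits.NavierStokesRegularity.NavierStokesRegularity.Theorems.ScarRigidity.Negative.LogicAndLoadBearing
import Literature.Analysis.FluidPDE.ClassicalSolution
import HarnessLib

/-!
# drefute gift: a sorry-free proof of stub `stub_farFieldOfScar` (S1b) of line finite-energy-log-convexity

Statement verbatim from `Cruxes/ScarRigidity/Lines/finite-energy-log-convexity.lean` (lead's skeleton,
2026-08-16T00:17Z).  Elementary: mean value inequality in time + "ess-sup small on `(−δ,0)×K` and continuous
⇒ pointwise small" on the ball `K = closedBall x (‖x‖/2)`.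
-/

noncomputable section

open Set Filter Function MeasureTheory Metric TopologicalSpace
open scoped Topology ENNReal NNReal
open Literature.Analysis.FluidPDE
open Summit.NavierStokesRegularity.NavierStokesRegularity.Theses.RellichScar
open Summit.NavierStokesRegularity.NavierStokesRegularity.Theorems.ScarRigidity.Negative

namespace Refuter.Drefute.FELC.S1b

/-- Physical space. -/
local notation "ℝ³" => EuclideanSpace ℝ (Fin 3)

/-- Time slices through a fixed point of a jointly smooth field are differentiable at interior times. -/
theorem differentiableAt_slice {V : ℝ → ℝ³ → ℝ³} (hV : IsSmoothSpaceTimeOn (Iio (0 : ℝ)) V)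
    (x : ℝ³) {s : ℝ} (hs : s < 0) : DifferentiableAt ℝ (fun τ => V τ x) s := by
  have hmem : (Iio (0 : ℝ) ×ˢ (univ : Set ℝ³)) ∈ 𝓝 (s, x) :=
    (isOpen_Iio.prod isOpen_univ).mem_nhds (mk_mem_prod hs (mem_univ x))
  have h0 : ContDiffOn ℝ _ (uncurry V) (Iio (0 : ℝ) ×ˢ (univ : Set ℝ³)) := hV
  have h1 : DifferentiableAt ℝ (uncurry V) (s, x) :=
    (h0.contDiffAt hmem).differentiableAt (by simp)
  have h2 : DifferentiableAt ℝ (fun τ : ℝ => (τ, x)) s :=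
    differentiableAt_id.prodMk (differentiableAt_const x)
  exact h1.comp s h2

/-- ESS-SUP SMALL + CONTINUOUS ⇒ POINTWISE SMALL on an open subset of the sampled set. -/
theorem norm_le_of_ae_lt {S U : Set (ℝ × ℝ³)} {w : ℝ × ℝ³ → ℝ³} {ε : ℝ} (hε : 0 ≤ ε)
    (hU : IsOpen U) (hUS : U ⊆ S) (hw : ContinuousOn w U)
    (hsmall : ∀ᵐ z ∂(volume.restrict S), ‖w z‖ₑ < ENNReal.ofReal ε) {z : ℝ × ℝ³} (hz : z ∈ U) :
    ‖w z‖ ≤ ε := by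
  by_contra hcon
  have hlt : ε < ‖w z‖ := not_le.1 hcon
  -- the open set where `‖w‖ > ε`
  set A : Set (ℝ × ℝ³) := U ∩ (fun z => ‖w z‖) ⁻¹' Ioi ε with hA
  have hAopen : IsOpen A := (hw.norm).isOpen_inter_preimage hU isOpen_Ioi
  have hzA : z ∈ A := ⟨hz, hlt⟩
  have hApos : 0 < volume A := hAopen.measure_pos volume ⟨z, hzA⟩
  have hAS : A ⊆ S := fun y hy => hUS hy.1
  -- but `A` is a null set for `volume.restrict S`
  have hnull : volume.restrict S A = 0 := by
    refine measure_eq_zero_iff_ae_notMem.2 ?_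
    filter_upwards [hsmall] with y hy hyA
    have h2 : ε < ‖w y‖ := hyA.2
    have h1 : ENNReal.ofReal ε < ‖w y‖ₑ := by
      rw [← ofReal_norm]
      exact (ENNReal.ofReal_lt_ofReal_iff (hε.trans_lt h2)).2 h2
    exact lt_irrefl _ (h1.trans hy)
  have hA0 : volume A = 0 := by
    rw [← inter_eq_left.2 hAS, ← Measure.restrict_apply hAopen.measurableSet]
    exact hnull
  exact absurd hA0 hApos.ne'

/-- **S1b, proved** (statement verbatim from the lead's skeleton). -/
theorem stub_farFieldOfScar :
    ∀ (u₁ u₂ V₁ V₂ : ℝ → ℝ³ → ℝ³) (L₁ L₂ : ℝ),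
      IsSmoothSpaceTimeOn (Iio (0 : ℝ)) V₁ → IsSmoothSpaceTimeOn (Iio (0 : ℝ)) V₂ →
      uncurry V₁ =ᵐ[volume.restrict (Iio (0 : ℝ) ×ˢ (univ : Set ℝ³))] uncurry u₁ →
      uncurry V₂ =ᵐ[volume.restrict (Iio (0 : ℝ) ×ˢ (univ : Set ℝ³))] uncurry u₂ →
      (∀ t < 0, ∀ x : ℝ³, ‖deriv (fun s => V₁ s x) t‖ ≤ L₁ / (‖x‖ + Real.sqrt (-t)) ^ 3) →
      (∀ t < 0, ∀ x : ℝ³, ‖deriv (fun s => V₂ s x) t‖ ≤ L₂ / (‖x‖ + Real.sqrt (-t)) ^ 3) →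
      SameScar u₁ u₂ →
      ∀ t < 0, ∀ x : ℝ³, x ≠ 0 → ‖V₁ t x - V₂ t x‖ ≤ (L₁ + L₂) * (-t) / ‖x‖ ^ 3 := by
  intro u₁ u₂ V₁ V₂ L₁ L₂ hV₁ hV₂ hae₁ hae₂ hd₁ hd₂ hscar t ht x hx
  have hxpos : 0 < ‖x‖ := norm_pos_iff.2 hx
  have hden : ∀ s : ℝ, 0 < ‖x‖ + Real.sqrt (-s) := fun s =>
    add_pos_of_pos_of_nonneg hxpos (Real.sqrt_nonneg _)
  -- the constants are nonnegative (the hypotheses at `(t, x)` would otherwise be violated)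
  have hL₁ : 0 ≤ L₁ := by
    by_contra hneg
    have h := hd₁ t ht x
    have : L₁ / (‖x‖ + Real.sqrt (-t)) ^ 3 < 0 :=
      div_neg_of_neg_of_pos (not_le.1 hneg) (pow_pos (hden t) 3)
    linarith [norm_nonneg (deriv (fun s => V₁ s x) t)]
  have hL₂ : 0 ≤ L₂ := by
    by_contra hneg
    have h := hd₂ t ht x
    have : L₂ / (‖x‖ + Real.sqrt (-t)) ^ 3 < 0 :=
      div_neg_of_neg_of_pos (not_le.1 hneg) (pow_pos (hden t) 3)
    linarith [norm_nonneg (deriv (fun s => V₂ s x) t)]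
  -- the time slice of the difference and its uniform derivative bound `M`
  set g : ℝ → ℝ³ := fun s => V₁ s x - V₂ s x with hg
  set M : ℝ := (L₁ + L₂) / ‖x‖ ^ 3 with hM
  have hM0 : 0 ≤ M := div_nonneg (add_nonneg hL₁ hL₂) (pow_nonneg hxpos.le 3)
  have hdiff : ∀ s ∈ Iio (0 : ℝ), DifferentiableAt ℝ g s := fun s hs =>
    (differentiableAt_slice hV₁ x hs).sub (differentiableAt_slice hV₂ x hs)
  have hbound : ∀ s ∈ Iio (0 : ℝ), ‖deriv g s‖ ≤ M := by
    intro s hs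
    have hs' : s < 0 := hs
    have hderiv : deriv g s = deriv (fun τ => V₁ τ x) s - deriv (fun τ => V₂ τ x) s :=
      deriv_sub (differentiableAt_slice hV₁ x hs') (differentiableAt_slice hV₂ x hs')
    have hcube : ‖x‖ ^ 3 ≤ (‖x‖ + Real.sqrt (-s)) ^ 3 :=
      pow_le_pow_left₀ hxpos.le (le_add_of_nonneg_right (Real.sqrt_nonneg _)) 3
    calc ‖deriv g s‖ = ‖deriv (fun τ => V₁ τ x) s - deriv (fun τ => V₂ τ x) s‖ := by rw [hderiv]
      _ ≤ ‖deriv (fun τ => V₁ τ x) s‖ + ‖deriv (fun τ => V₂ τ x) s‖ := norm_sub_le _ _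
      _ ≤ L₁ / (‖x‖ + Real.sqrt (-s)) ^ 3 + L₂ / (‖x‖ + Real.sqrt (-s)) ^ 3 :=
          add_le_add (hd₁ s hs' x) (hd₂ s hs' x)
      _ = (L₁ + L₂) / (‖x‖ + Real.sqrt (-s)) ^ 3 := by ring
      _ ≤ M := div_le_div_of_nonneg_left (add_nonneg hL₁ hL₂) (pow_pos hxpos 3) hcube
  -- smallness of `g` near the final time, from the scar on `K = closedBall x (‖x‖/2)`
  have hsmall : ∀ ε > 0, ∃ δ > 0, ∀ s, -δ < s → s < 0 → ‖g s‖ ≤ ε := by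
    intro ε hε
    set K : Set ℝ³ := closedBall x (‖x‖ / 2) with hK
    have hKc : IsCompact K := isCompact_closedBall _ _
    have h0K : (0 : ℝ³) ∉ K := by
      intro h0
      have : dist (0 : ℝ³) x ≤ ‖x‖ / 2 := mem_closedBall.1 h0
      rw [dist_eq_norm, zero_sub, norm_neg] at this
      linarith
    have hT := hscar K hKc h0K
    have hpos : (0 : ℝ≥0∞) < ENNReal.ofReal ε := ENNReal.ofReal_pos.2 hε
    have hev : ∀ᶠ δ in 𝓝[>] (0 : ℝ),
        eLpNorm (uncurry u₁ - uncurry u₂) ⊤ (volume.restrict (Ioo (-δ) 0 ×ˢ K)) <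
          ENNReal.ofReal ε := (tendsto_order.1 hT).2 _ hpos
    obtain ⟨δ, hδN, hδpos⟩ := (hev.and eventually_mem_nhdsWithin).exists
    refine ⟨δ, hδpos, fun s hs₁ hs₂ => ?_⟩
    set S : Set (ℝ × ℝ³) := Ioo (-δ) 0 ×ˢ K with hS
    have hSsub : S ⊆ Iio (0 : ℝ) ×ˢ (univ : Set ℝ³) := prod_mono Ioo_subset_Iio_self (subset_univ _)
    have haeS : ∀ᵐ z ∂(volume.restrict S),
        (uncurry u₁ - uncurry u₂) z = (uncurry V₁ - uncurry V₂) z := by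
      have h : ∀ᵐ z ∂(volume.restrict (Iio (0 : ℝ) ×ˢ (univ : Set ℝ³))),
          (uncurry u₁ - uncurry u₂) z = (uncurry V₁ - uncurry V₂) z := by
        filter_upwards [hae₁, hae₂] with z h1 h2
        simp only [Pi.sub_apply, h1, h2]
      exact ae_restrict_of_ae_restrict_of_subset hSsub h
    have hess : eLpNorm (uncurry V₁ - uncurry V₂) ⊤ (volume.restrict S) < ENNReal.ofReal ε := by
      rwa [← eLpNorm_congr_ae haeS]
    have hae_lt : ∀ᵐ z ∂(volume.restrict S), ‖(uncurry V₁ - uncurry V₂) z‖ₑ < ENNReal.ofReal ε := by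
      rw [eLpNorm_exponent_top] at hess
      exact ae_lt_of_essSup_lt hess
    -- pass to the open sub-box `U` and use continuity
    set U : Set (ℝ × ℝ³) := Ioo (-δ) 0 ×ˢ ball x (‖x‖ / 2) with hU
    have hUo : IsOpen U := isOpen_Ioo.prod isOpen_ball
    have hUS : U ⊆ S := prod_mono Subset.rfl ball_subset_closedBall
    have hUslab : U ⊆ Iio (0 : ℝ) ×ˢ (univ : Set ℝ³) := hUS.trans hSsub
    have hw : ContinuousOn (uncurry V₁ - uncurry V₂) U :=
      (hV₁.continuousOn.mono hUslab).sub (hV₂.continuousOn.mono hUslab)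
    have hzU : ((s, x) : ℝ × ℝ³) ∈ U := mk_mem_prod ⟨hs₁, hs₂⟩ (mem_ball_self (half_pos hxpos))
    have := norm_le_of_ae_lt hε.le hUo hUS hw hae_lt hzU
    simpa [hg] using this
  -- conclusion: mean value inequality on `[t, s]`, then `s ↑ 0`, `ε ↓ 0`
  refine le_of_forall_pos_le_add fun ε hε => ?_
  obtain ⟨δ, hδ, hδs⟩ := hsmall ε hε
  set s : ℝ := -(min δ (-t)) / 2 with hs
  have hmin : 0 < min δ (-t) := lt_min hδ (by linarith)
  have hs0 : s < 0 := by rw [hs]; linarith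
  have hsδ : -δ < s := by
    rw [hs]; have := min_le_left δ (-t); linarith
  have hts : t ≤ s := by
    rw [hs]; have := min_le_right δ (-t); linarith
  have hMVT : ‖g t - g s‖ ≤ M * ‖t - s‖ :=
    (convex_Iio (0 : ℝ)).norm_image_sub_le_of_norm_deriv_le hdiff hbound hs0 ht
  have hnorm : ‖t - s‖ = s - t := by
    rw [Real.norm_eq_abs, abs_sub_comm, abs_of_nonneg (by linarith)]
  have hgt : g t = V₁ t x - V₂ t x := rfl
  calc ‖V₁ t x - V₂ t x‖ = ‖(g t - g s) + g s‖ := by rw [hgt]; abel_nf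
    _ ≤ ‖g t - g s‖ + ‖g s‖ := norm_add_le _ _
    _ ≤ M * ‖t - s‖ + ε := add_le_add hMVT (hδs s hsδ hs0)
    _ ≤ M * (-t) + ε := by
        rw [hnorm]
        have : s - t ≤ -t := by linarith
        nlinarith [hM0]
    _ = (L₁ + L₂) * (-t) / ‖x‖ ^ 3 + ε := by rw [hM]; ring

end Refuter.Drefute.FELC.S1b

end
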